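import Summits.QuantumFields.YangMills.Theorems.LuscherReductionDressedRitzPolyakovLiftShadowLipschitz
import Summits.QuantumFields.YangMills.Theorems.LuscherReductionDressedRitzPolyakovLiftEquatorNull
import HarnessLib

/-!
# Crux `DressedRitz` (stmt-QuantumFields-20205), line «polyakovlift» r6, wave 2 / F8c part 3 — the Lipschitz bound of the shadow observable holds
# ALMOST EVERYWHERE in the product measure

Support module (fleet seat ym-20205-polyakovlift-s1 gen 2, for the LEAD's wave-2 brief W2-F8 (c); `--supports stmt-QuantumFields-20205`, helper, no closure claim).
Part 2 (`…ShadowLipschitz`, `shadowObs_powLink_sub_sq_le`) bounds `(g(U^L) − g(V^L))²` by `Lg·L²·cfgDist U V` for `U, V` all of whose links have `L`-th powers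
off the equator `{u₀ = 0}` (where the gnomonic coordinate takes its junk value and `g` genuinely jumps).  The exceptional set is null — seat ym-infvol-p1 g7's
`…PolyakovLiftEquatorNull` (`haar_scalarPart_pow_eq_zero_null`: `scalarPart (W^L)` is a non-zero polynomial in `scalarPart W`, every level set of the scalar part is
Haar-null by the gnomonic decomposition of Haar) — so the bound holds for `(μ ⊗ μ)`-almost every pair, the form an integral against `η(U)η(V)K_B(U,V)` consumes:

* `ae_scalarPart_pow_ne_zero` — for `μ = configMeasure SU2 1`: a.e. `U` has every `(U e)^L` off the equator (all links `e`, from `haar_scalarPart_pow_eq_zero_null`);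
* ★★★ `shadowObs_powLink_sub_sq_le_ae` — **for `(μ⊗μ)`-a.e. `(U,V)`: `(g(powLink L U) − g(powLink L V))² ≤ Lg·L²·cfgDist U V`**, every `L ≥ 1`, with ONE `Lg ≥ 0`
  depending on `Λ, R, f, i` only (`g = transplantObsL L Λ R f i`).

HONEST FRAMING: measure-zero bookkeeping at fixed lattice on the conditional femto rung R2b1; serves ONE stub's (S-PSCAL″) soft error (off its critical path since the
LEAD's F9 redesign of 2026-08-27T19:23Z); nothing here bears on infinite volume, the continuum limit or the Clay gap.
References: Bröcker–tom Dieck [cite: BrockerTomDieck1985, I (1.10), IV (2.2)]; M. Lüscher, NPB 219 (1983) 233 [cite: Luscher1983, §2–§3].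
-/

set_option autoImplicit false

noncomputable section

open MeasureTheory Filter Topology Real
open scoped Matrix ComplexConjugate BigOperators NNReal ENNReal
open Literature.MathematicalPhysics.QuantumFieldTheory
open Literature.MathematicalPhysics.QuantumLattice
open Literature.Analysis.OperatorTheory.YMMatrixModel

namespace Summit.QuantumFields.YangMills.Theorems.FemtoTransferGap.PolyakovLift

open Summit.QuantumFields.YangMills.Theorems.FemtoTransferGap

/-- ★ Almost every one-site configuration has the `L`-th power of EVERY link off the equator (product of Haar measures; per link
`haar_scalarPart_pow_eq_zero_null`). [cite: BrockerTomDieck1985, IV (2.2)] -/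
theorem ae_scalarPart_pow_ne_zero (L : ℕ) : ∀ᵐ U ∂(configMeasure SU2 1), ∀ e, scalarPart (U e ^ L) ≠ 0 := by
  haveI := secondCountableTopology_su2
  have hE : MeasurableSet {W : SU2 | scalarPart (W ^ L) = 0} :=
    (continuous_scalarPart.comp (continuous_pow L)).measurable (measurableSet_singleton 0)
  rw [ae_all_iff]
  intro e
  have : (configMeasure SU2 1) {U : Cfg | scalarPart (U e ^ L) = 0} = 0 := by
    have hsub : {U : Cfg | scalarPart (U e ^ L) = 0} = (fun U : Cfg => U e) ⁻¹' {W : SU2 | scalarPart (W ^ L) = 0} := rfl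
    rw [hsub, ← Measure.map_apply (measurable_pi_apply e) hE]
    unfold configMeasure
    rw [Measure.pi_map_eval]
    simp [haar_scalarPart_pow_eq_zero_null L]
  rw [ae_iff]
  simpa using this

variable {k : ℕ}

/-- ★★★ **W2-F8c, almost-everywhere form**: for `g = transplantObsL L Λ R f i` (`0 < Λ`, `1 ≤ R`, `RΛ ≤ 1/4`, AL1 family `f` with `f_0 > 0`) there is
`Lg ≥ 0` depending on `Λ, R, f, i` ONLY such that for every `L ≥ 1`, for `(μ ⊗ μ)`-almost every pair `(U, V)` of one-site configurations
`(g(powLink L U) − g(powLink L V))² ≤ Lg · L² · cfgDist U V`. [cite: Luscher1983, §2–§3] -/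
theorem shadowObs_powLink_sub_sq_le_ae {Λ R : ℝ} (hΛ : 0 < Λ) (hR1 : 1 ≤ R) (hRΛ : R * Λ ≤ 1 / 4) {f : Fin (k + 1) → ZM → ℝ}
    (hf : IsEigenFamily k f) (hpos : ∀ x, 0 < f 0 x) (i : Fin k) :
    ∃ Lg : ℝ, 0 ≤ Lg ∧ ∀ (L : ℕ), 1 ≤ L → ∀ᵐ p ∂((configMeasure SU2 1).prod (configMeasure SU2 1)),
      (transplantObsL L Λ R f i (powLink L p.1) - transplantObsL L Λ R f i (powLink L p.2)) ^ 2 ≤ Lg * (L : ℝ) ^ 2 * cfgDist p.1 p.2 := by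
  obtain ⟨Lg, hLg, h⟩ := shadowObs_powLink_sub_sq_le hΛ hR1 hRΛ hf hpos i
  refine ⟨Lg, hLg, fun L hL => ?_⟩
  have h1 : ∀ᵐ p ∂((configMeasure SU2 1).prod (configMeasure SU2 1)), ∀ e, scalarPart ((p.1 : Cfg) e ^ L) ≠ 0 :=
    Measure.quasiMeasurePreserving_fst.ae (ae_scalarPart_pow_ne_zero L)
  have h2 : ∀ᵐ p ∂((configMeasure SU2 1).prod (configMeasure SU2 1)), ∀ e, scalarPart ((p.2 : Cfg) e ^ L) ≠ 0 :=
    Measure.quasiMeasurePreserving_snd.ae (ae_scalarPart_pow_ne_zero L)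
  filter_upwards [h1, h2] with p hp1 hp2
  exact h L hL p.1 p.2 hp1 hp2

end Summit.QuantumFields.YangMills.Theorems.FemtoTransferGap.PolyakovLift

end
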